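import Literature.NumberTheory.Transcendental.KZRayDilog
import Literature.NumberTheory.Transcendental.KZLogCalculusProofs

/-!
# `OffTetraSectorKernel`, line `odd-hyperbolic-ladder`: the substitution `u = v²` on Zagier's ray
representation (stub `stub_raySqrt`)

Stub `stub_raySqrt` of the crux `OffTetraSectorKernel` (stmt-KontsevichZagierPeriods-10557, route
HyperbolicBloch): ONE instance of Kontsevich–Zagier's rule (2). Notation: `z = a + ib` with `a`, `b`
real algebraic, `b > 0`, `r > 0` with `r² = a² + b²` (`r = |z|`), `q(s) = (1 − s a)² + (s b)² > 0`;
points `w : Fin 2 → ℝ` of the plane have `w 0 = s` (ray parameter) and `w 1` the log sheet.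
Zagier's ray representation `R = [KZ.rayDilogDomain a b, KZ.rayDilogIntegrand a b]` lives on
`{0 < s < 1, u strictly between 1 and s²(a² + b²) = (s r)²}` with integrand
`sgn(u − 1)(−b)/(2 u q(s))`; its pull-back `R₁` along the fibrewise squaring map
`Φ(s, v) = (s, v²)` (`v > 0`) lives on `{0 < s < 1, v strictly between 1 and s r}` with integrand
`sgn(v − 1)(−b)/(v q(s)) = sgn(v² − 1)(−b)/(2 v² q(s)) · |2 v|`. The map `Φ` is polynomial with
rational coefficients (hence a `ℚ`-semialgebraic map on every `ℚ`-semialgebraic set), injective on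
`{v > 0}`, with derivative `diag(1, 2v)` of determinant `2v`, and it maps the domain of `R₁` ONTO
the ray domain (inverse `v = √u`). Hence `[R₁] − [R] ∈ KZ.changeOfVariablesRel ⊆ KZ.relations`,
and `[R] − [R₁] = −([R₁] − [R])` is a relation as well.

References: M. Kontsevich, D. Zagier, *Periods* (2001), §1.2 rule (2); D. Zagier, *The dilogarithm
function* (2007), Ch. I §3.
-/

noncomputable section

open Set MeasureTheory MvPolynomial
open Literature.NumberTheory.Transcendental Literature.ModelTheory.ExponentialFields

namespace Summit.KontsevichZagierPeriods.HyperbolicBloch.OffTetraSectorKernel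

/-! ## Algebra of the squaring map -/

/-- The coordinates of the fibrewise squaring map `Φ(s, v) = (s, v²)`. [folklore] -/
theorem raySqrt_apply (Φ : (Fin 2 → ℝ) → (Fin 2 → ℝ)) (hΦ : ∀ v, Φ v = ![v 0, v 1 ^ 2])
    (v : Fin 2 → ℝ) : Φ v 0 = v 0 ∧ Φ v 1 = v 1 ^ 2 := by
  rw [hΦ]
  exact ⟨rfl, rfl⟩

/-- On the two-sheeted domain `{0 < s < 1, v strictly between 1 and s r}` (`r > 0`) the fibre
coordinate is positive: `v > 1` on the upper sheet, `v > s r > 0` on the lower one. [folklore] -/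
theorem raySqrt_pos {r : ℝ} (hr : 0 < r) {w : Fin 2 → ℝ}
    (hw : (0 < w 0 ∧ w 0 < 1) ∧ ((1 < w 1 ∧ w 1 < w 0 * r) ∨ (w 0 * r < w 1 ∧ w 1 < 1))) :
    0 < w 1 := by
  rcases hw with ⟨⟨h0, -⟩, ⟨h1, -⟩ | ⟨h1, -⟩⟩
  · exact zero_lt_one.trans h1
  · exact (mul_pos h0 hr).trans h1

/-- **The image of the two-sheeted `v`-domain under `Φ(s, v) = (s, v²)` is Zagier's ray domain**
`KZ.rayDilogDomain a b = {0 < s < 1, u strictly between 1 and s²(a² + b²)}` when `r > 0`,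
`r² = a² + b²`: squaring is an increasing bijection of `(0, ∞)` (inverse `√`), `1² = 1` and
`(s r)² = s²(a² + b²)`. [cite: Zagier2007Dilogarithm, Ch. I §3] -/
theorem raySqrt_image (Φ : (Fin 2 → ℝ) → (Fin 2 → ℝ)) (hΦ : ∀ v, Φ v = ![v 0, v 1 ^ 2])
    {a b r : ℝ} (hr : 0 < r) (hr2 : r ^ 2 = a ^ 2 + b ^ 2) :
    Φ '' {w : Fin 2 → ℝ | (0 < w 0 ∧ w 0 < 1) ∧
        ((1 < w 1 ∧ w 1 < w 0 * r) ∨ (w 0 * r < w 1 ∧ w 1 < 1))} = KZ.rayDilogDomain a b := by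
  ext w
  constructor
  · -- `Φ` maps the `v`-domain into the ray domain
    rintro ⟨v, ⟨⟨h0, h1⟩, hv⟩, rfl⟩
    obtain ⟨e0, e1⟩ := raySqrt_apply Φ hΦ v
    have hkey : v 0 ^ 2 * (a ^ 2 + b ^ 2) = (v 0 * r) ^ 2 := by
      rw [← hr2]
      ring
    simp only [KZ.rayDilogDomain, mem_setOf_eq, e0, e1, hkey]
    refine ⟨h0, h1, ?_⟩
    rcases hv with ⟨hv1, hv2⟩ | ⟨hv1, hv2⟩
    · have hv0 : 0 ≤ v 1 := zero_le_one.trans hv1.le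
      exact Or.inl ⟨(one_lt_sq_iff₀ hv0).2 hv1, pow_lt_pow_left₀ hv2 hv0 two_ne_zero⟩
    · have hsr : 0 ≤ v 0 * r := (mul_pos h0 hr).le
      have hv0 : 0 ≤ v 1 := hsr.trans hv1.le
      exact Or.inr ⟨pow_lt_pow_left₀ hv1 hsr two_ne_zero, (sq_lt_one_iff₀ hv0).2 hv2⟩
  · -- the ray domain is covered: `v = √u`
    rintro ⟨h0, h1, hw⟩
    have hkey : w 0 ^ 2 * (a ^ 2 + b ^ 2) = (w 0 * r) ^ 2 := by
      rw [← hr2]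
      ring
    rw [hkey] at hw
    have hsr : 0 < w 0 * r := mul_pos h0 hr
    have hw1 : 0 < w 1 := by
      rcases hw with ⟨h, -⟩ | ⟨h, -⟩
      · exact zero_lt_one.trans h
      · exact (pow_pos hsr 2).trans h
    refine ⟨![w 0, Real.sqrt (w 1)], ?_, ?_⟩
    · simp only [mem_setOf_eq, Matrix.cons_val_zero, Matrix.cons_val_one,
        Matrix.cons_val_fin_one]
      refine ⟨⟨h0, h1⟩, ?_⟩
      rcases hw with ⟨hw2, hw3⟩ | ⟨hw2, hw3⟩
      · refine Or.inl ⟨?_, ?_⟩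
        · rw [Real.lt_sqrt zero_le_one, one_pow]
          exact hw2
        · rw [Real.sqrt_lt' hsr]
          exact hw3
      · refine Or.inr ⟨?_, ?_⟩
        · rw [Real.lt_sqrt hsr.le]
          exact hw2
        · rw [Real.sqrt_lt' one_pos, one_pow]
          exact hw3
    · rw [hΦ]
      funext i
      fin_cases i
      · simp
      · simp [Real.sq_sqrt hw1.le]

/-- The squaring map `Φ(s, v) = (s, v²)` is injective on the two-sheeted `v`-domain (`r > 0`): the
first coordinate is kept and `v ↦ v²` is injective on `v > 0`. [folklore] -/
theorem raySqrt_injOn (Φ : (Fin 2 → ℝ) → (Fin 2 → ℝ)) (hΦ : ∀ v, Φ v = ![v 0, v 1 ^ 2])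
    {r : ℝ} (hr : 0 < r) :
    InjOn Φ {w : Fin 2 → ℝ | (0 < w 0 ∧ w 0 < 1) ∧
      ((1 < w 1 ∧ w 1 < w 0 * r) ∨ (w 0 * r < w 1 ∧ w 1 < 1))} := by
  intro v hv v' hv' h
  obtain ⟨e0, e1⟩ := raySqrt_apply Φ hΦ v
  obtain ⟨e0', e1'⟩ := raySqrt_apply Φ hΦ v'
  have h0 : v 0 = v' 0 := by rw [← e0, ← e0', h]
  have h1 : v 1 ^ 2 = v' 1 ^ 2 := by rw [← e1, ← e1', h]
  have h1' : v 1 = v' 1 :=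
    (pow_left_inj₀ (raySqrt_pos hr hv).le (raySqrt_pos hr hv').le two_ne_zero).1 h1
  funext i
  fin_cases i
  exacts [h0, h1']

/-! ## Semialgebraicity -/

/-- The squaring map `Φ(s, v) = (s, v²)` is a `ℚ`-semialgebraic map on every `ℚ`-semialgebraic
set: its coordinates `s`, `v²` are polynomials with rational coefficients.
[cite: KontsevichZagier2001, §1.1] -/
theorem raySqrt_isSemialgebraicMapOn (Φ : (Fin 2 → ℝ) → (Fin 2 → ℝ))
    (hΦ : ∀ v, Φ v = ![v 0, v 1 ^ 2]) {σ : Set (Fin 2 → ℝ)} (hσ : IsSemialgebraic ℚ σ) :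
    IsSemialgebraicMapOn ℚ σ Φ := by
  have s0 : IsSemialgebraicFunOn ℚ σ (fun w => w 0) :=
    (isSemialgebraicFunOn_aeval hσ (X 0)).congr fun w _ => by simp
  have s1 : IsSemialgebraicFunOn ℚ σ (fun w => w 1) :=
    (isSemialgebraicFunOn_aeval hσ (X 1)).congr fun w _ => by simp
  refine IsSemialgebraicMapOn.of_forall hσ fun j => ?_
  fin_cases j
  · exact s0.congr fun w _ => by simp [(raySqrt_apply Φ hΦ w).1]
  · exact (IsSemialgebraicFunOn.mul_holds s1 s1).congr fun w _ => by
      simp [(raySqrt_apply Φ hΦ w).2, sq]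

/-! ## The derivative -/

/-- **The derivative of the squaring map and its determinant.** `Φ(s, v) = (s, v²)` is
polynomial; at every point it has the Fréchet derivative of matrix `diag(1, 2v)`, of determinant
`2v`. [folklore] -/
theorem raySqrt_hasFDerivAt_det (Φ : (Fin 2 → ℝ) → (Fin 2 → ℝ))
    (hΦ : ∀ v, Φ v = ![v 0, v 1 ^ 2]) (v : Fin 2 → ℝ) :
    ∃ L : (Fin 2 → ℝ) →L[ℝ] (Fin 2 → ℝ), HasFDerivAt Φ L v ∧ L.det = 2 * v 1 := by
  set M : Matrix (Fin 2) (Fin 2) ℝ := !![1, 0; 0, 2 * v 1] with hM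
  refine ⟨LinearMap.toContinuousLinearMap (Matrix.toLin' M), ?_, ?_⟩
  · -- derivative, componentwise
    have e0 : HasFDerivAt (fun x : Fin 2 → ℝ => x 0) (ContinuousLinearMap.proj 0) v :=
      hasFDerivAt_apply (𝕜 := ℝ) 0 v
    have e1 : HasFDerivAt (fun x : Fin 2 → ℝ => x 1) (ContinuousLinearMap.proj 1) v :=
      hasFDerivAt_apply (𝕜 := ℝ) 1 v
    have h0 : HasFDerivAt (fun x => Φ x 0)
        ((ContinuousLinearMap.proj 0).comp (LinearMap.toContinuousLinearMap (Matrix.toLin' M)))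
        v := by
      have hf : (fun x => Φ x 0) = fun x : Fin 2 → ℝ => x 0 := by
        funext x
        exact (raySqrt_apply Φ hΦ x).1
      rw [hf]
      refine e0.congr_fderiv (ContinuousLinearMap.ext fun u => ?_)
      simp [hM, Matrix.toLin'_apply, dotProduct, Fin.sum_univ_two]
    have h1 : HasFDerivAt (fun x => Φ x 1)
        ((ContinuousLinearMap.proj 1).comp (LinearMap.toContinuousLinearMap (Matrix.toLin' M)))
        v := by
      have hf : (fun x => Φ x 1) = fun x : Fin 2 → ℝ => x 1 * x 1 := by
        funext x
        rw [(raySqrt_apply Φ hΦ x).2, sq]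
      rw [hf]
      refine (e1.fun_mul e1).congr_fderiv (ContinuousLinearMap.ext fun u => ?_)
      simp [hM, Matrix.toLin'_apply, dotProduct, Fin.sum_univ_two]
      ring
    refine hasFDerivAt_pi'' fun i => ?_
    fin_cases i
    exacts [h0, h1]
  · -- determinant
    rw [LinearMap.det_toContinuousLinearMap, LinearMap.det_toLin', hM, Matrix.det_fin_two_of]
    ring

/-! ## The stub -/

/-- **STUB `stub_raySqrt`** (rule (2), ONE move): on Zagier's ray representation
`R = [rayDilogDomain a b, rayDilogIntegrand a b]` (fibre `u` strictly between `1` and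
`s²(a² + b²)`, integrand `sgn(u − 1)(−b)/(2u((1 − sa)² + (sb)²))`) the fibrewise substitution
`u = v²` (`v > 0`, Jacobian `2v`) gives the representation `R₁` with fibre `v` strictly between `1`
and `s r` (`r = √(a² + b²)`) and integrand `sgn(v − 1)(−b)/(v((1 − sa)² + (sb)²))`:
`[R₁] − [R] ∈ changeOfVariablesRel` for the squaring map `Φ(s, v) = (s, v²)` (semialgebraic,
injective on `v > 0`, derivative `diag(1, 2v)`, image the ray domain,
`sgn(v − 1)(−b)/(v q) = sgn(v² − 1)(−b)/(2 v² q) · |2v|`), whence `[R] − [R₁] ∈ relations`.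
[cite: KontsevichZagier2001, §1.2 rule (2)] -/
theorem stub_raySqrt :
    ∀ (a b r : ℝ), IsAlgebraic ℚ a → IsAlgebraic ℚ b → IsAlgebraic ℚ r → 0 < b → 0 < r → r ^ 2 = a ^ 2 + b ^ 2 →
    ∀ (R R₁ : KZ.IntegralRep 2),
      R.domain = KZ.rayDilogDomain a b → Set.EqOn R.integrand (KZ.rayDilogIntegrand a b) R.domain →
      R₁.domain = {w | (0 < w 0 ∧ w 0 < 1) ∧ ((1 < w 1 ∧ w 1 < w 0 * r) ∨ (w 0 * r < w 1 ∧ w 1 < 1))} →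
      Set.EqOn R₁.integrand
        (fun w => (if 1 < w 1 then (1 : ℝ) else -1) * (-b) / (w 1 * ((1 - w 0 * a) ^ 2 + (w 0 * b) ^ 2))) R₁.domain →
      KZ.of R - KZ.of R₁ ∈ KZ.relations := by
  intro a b r _ _ _ hb hr hr2 R R₁ hR hRi hR₁ hR₁i
  -- the move `Φ(s, v) = (s, v²)`
  obtain ⟨Φ, hΦ⟩ : ∃ Φ : (Fin 2 → ℝ) → (Fin 2 → ℝ), ∀ v, Φ v = ![v 0, v 1 ^ 2] :=
    ⟨_, fun _ => rfl⟩
  -- the image is the ray domain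
  have himage : Φ '' R₁.domain = R.domain := by
    rw [hR₁, hR]
    exact raySqrt_image Φ hΦ hr hr2
  -- the four data of the move
  have hΦsa : IsSemialgebraicMapOn ℚ R₁.domain Φ :=
    raySqrt_isSemialgebraicMapOn Φ hΦ R₁.isSemialgebraic_domain
  have hinj : InjOn Φ R₁.domain := by
    rw [hR₁]
    exact raySqrt_injOn Φ hΦ hr
  choose L hL using raySqrt_hasFDerivAt_det Φ hΦ
  have hderiv : ∀ x ∈ R₁.domain, HasFDerivWithinAt Φ (L x) R₁.domain x := fun x _ =>
    (hL x).1.hasFDerivWithinAt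
  -- `[R₁] − [R]` is ONE change-of-variables move
  have hmove : KZ.of R₁ - KZ.of R ∈ KZ.relations := by
    refine KZ.changeOfVariablesRel_subset_relations
      ⟨2, R₁, R, Φ, L, hΦsa, hderiv, hinj, himage.symm, fun x hx => ?_, rfl⟩
    -- the Jacobian identity `sgn(v − 1)(−b)/(v q) = sgn(v² − 1)(−b)/(2 v² q) · |2v|`
    have hx' : Φ x ∈ R.domain := himage ▸ mem_image_of_mem Φ hx
    have hxD := hx
    rw [hR₁] at hxD
    have hx1 : 0 < x 1 := raySqrt_pos hr hxD
    have hq : 0 < (1 - x 0 * a) ^ 2 + (x 0 * b) ^ 2 := KZ.rayDilog_den_pos hb.ne' a (x 0)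
    obtain ⟨e0, e1⟩ := raySqrt_apply Φ hΦ x
    have hsgn : (if 1 < x 1 ^ 2 then (1 : ℝ) else -1) = if 1 < x 1 then (1 : ℝ) else -1 := by
      simp only [one_lt_sq_iff₀ hx1.le]
    rw [hR₁i hx, hRi hx', (hL x).2, KZ.rayDilogIntegrand, e0, e1, hsgn,
      abs_of_pos (mul_pos two_pos hx1), div_mul_eq_mul_div,
      div_eq_div_iff (mul_pos hx1 hq).ne' (mul_pos (mul_pos two_pos (pow_pos hx1 2)) hq).ne']
    ring
  have hneg := KZ.relations.neg_mem hmove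
  rwa [neg_sub] at hneg

end Summit.KontsevichZagierPeriods.HyperbolicBloch.OffTetraSectorKernel

end
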